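import Summits.QuantumAdvantage.QuantumAdvantage.Theorems.LinnikCubicClassGroupsDegreeOnePrimesEscapeDivisionCount
import HarnessLib

/-!
# Frobenius divisions: the exact prime count behind the Möbius combination of Dedekind zetas

Topic `Summits/QuantumAdvantage/QuantumAdvantage/Theorems`, cell B2b-1 (linnik-cubic), PART A (gen 10);
helper toward the crux `DegreeOnePrimesEscape` (stmt-QuantumAdvantage-11543) of route
`LinnikCubicClassGroups`.  HONEST FRAMING: the value of this file is a THEOREM (kernel-checked group
theory and prime bookkeeping) — NOT summit progress.

Let `N/ℚ` be Galois with group `G` of order `n`, `σ ∈ G` of order `m`, `H_d = ⟨σ^d⟩`, `E_d = N^{H_d}`,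
`M = Σ_{d ∣ m} μ(d)/d`, and let `Div σ = {z : ⟨g z g⁻¹⟩ = ⟨σ⟩ for some g}` be the DIVISION of `σ`.
`…DivisionCount.lean` turned Frobenius' Möbius device into the one-sided inequality `division_sum_le`.
Here the count is made EXACT, as needed for a prime number theorem with relative error:

* `natCard_conj_zpowers_eq` — `#{g : ⟨g z g⁻¹⟩ = ⟨σ⟩} = |N_G(⟨σ⟩)|` for `z ∈ Div σ` (a coset of the
  normaliser) and `= 0` otherwise (`natCard_conj_zpowers_eq_zero`);
* `card_division_mul_card_normalizer` — `|Div σ| · |N_G(⟨σ⟩)| = m · |G| · M` (double counting with the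
  mean of the permutation characters), whence the Chebotarev density of the division
  `δ(σ) = |Div σ|/|G| = m M/|N_G(⟨σ⟩)|` (`divisionDensity_eq`) and `1/n ≤ δ(σ) ≤ 1`;
* `abs_divisionTheta_sub_le` — **the exact prime sum**:
  `|Σ_{d ∣ m} (μ(d)/d) θ¹_{E_d}(x) − (|N_G(⟨σ⟩)|/m) · Σ_{p ≤ x, p ∤ d_N, Frob_p ∈ Div σ} log p| ≤ n² log|d_N|`,
  where `Frob_p ∈ Div σ` means: some prime `Q ∣ p` of `N` with trivial inertia has an arithmetic Frobenius
  `φ` with `⟨g φ g⁻¹⟩ = ⟨σ⟩` for some `g` (Perlis' unramified dictionary `divisionWeight_eq`; the ramified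
  primes cost `≤ n² log|d_N|`).

References: G. Frobenius, S.-B. Preuss. Akad. Wiss. (1896) 689–703 [folklore]; J. C. Lagarias,
H. L. Montgomery, A. M. Odlyzko, Invent. Math. 54 (1979) [LagariasMontgomeryOdlyzko1979].
-/

noncomputable section

open scoped NumberField nonZeroDivisors
open Finset Real Ideal NumberField
open Literature.NumberTheory.NumberFields Literature.NumberTheory.LFunctions
  Literature.NumberTheory.LFunctions.NumberField

namespace Summit.QuantumAdvantage.QuantumAdvantage.Theorems.DegreeOnePrimesEscape

/-! ### Group theory: the division of `σ` and the normaliser of `⟨σ⟩` -/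

section GroupTheory

variable {G : Type*} [Group G]

/-- `y ∈ ⟨h w h⁻¹⟩ ↔ h⁻¹ y h ∈ ⟨w⟩`. -/
theorem mem_zpowers_conj_iff (h w y : G) :
    y ∈ Subgroup.zpowers (h * w * h⁻¹) ↔ h⁻¹ * y * h ∈ Subgroup.zpowers w := by
  rw [Subgroup.mem_zpowers_iff, Subgroup.mem_zpowers_iff]
  constructor
  · rintro ⟨k, rfl⟩
    exact ⟨k, by rw [conj_zpow]; group⟩
  · rintro ⟨k, hk⟩
    refine ⟨k, ?_⟩
    rw [conj_zpow, hk]; group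

/-- If `⟨w⟩ = ⟨σ⟩` then `⟨h w h⁻¹⟩ = ⟨σ⟩ ↔ h ∈ N_G(⟨σ⟩)`. -/
theorem zpowers_conj_eq_iff_mem_normalizer {w σ : G} (hw : Subgroup.zpowers w = Subgroup.zpowers σ)
    (h : G) : Subgroup.zpowers (h * w * h⁻¹) = Subgroup.zpowers σ ↔ h ∈ Subgroup.normalizer (Subgroup.zpowers σ : Set G) := by
  rw [Subgroup.mem_normalizer_iff'']
  constructor
  · intro heq y
    have := (SetLike.ext_iff.mp heq y)
    rw [mem_zpowers_conj_iff, hw] at this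
    exact this.symm
  · intro hmem
    ext y
    rw [mem_zpowers_conj_iff, hw]
    exact (hmem y).symm

/-- **The division count is a coset of the normaliser**: if `⟨g₀ z g₀⁻¹⟩ = ⟨σ⟩` for some `g₀` then
`#{g : ⟨g z g⁻¹⟩ = ⟨σ⟩} = |N_G(⟨σ⟩)|`. -/
theorem natCard_conj_zpowers_eq {σ z : G} (hz : ∃ g₀ : G, Subgroup.zpowers (g₀ * z * g₀⁻¹) = Subgroup.zpowers σ) :
    Nat.card {g : G // Subgroup.zpowers (g * z * g⁻¹) = Subgroup.zpowers σ} =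
      Nat.card (Subgroup.normalizer (Subgroup.zpowers σ : Set G)) := by
  obtain ⟨g₀, hg₀⟩ := hz
  refine Nat.card_congr
    { toFun := fun g => ⟨g.1 * g₀⁻¹, ?_⟩
      invFun := fun h => ⟨h.1 * g₀, ?_⟩
      left_inv := fun g => Subtype.ext (by simp)
      right_inv := fun h => Subtype.ext (by simp) }
  · have e : g.1 * g₀⁻¹ * (g₀ * z * g₀⁻¹) * (g.1 * g₀⁻¹)⁻¹ = g.1 * z * g.1⁻¹ := by group
    exact (zpowers_conj_eq_iff_mem_normalizer hg₀ _).mp (by rw [e]; exact g.2)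
  · have e : h.1 * g₀ * z * (h.1 * g₀)⁻¹ = h.1 * (g₀ * z * g₀⁻¹) * h.1⁻¹ := by group
    rw [e]
    exact (zpowers_conj_eq_iff_mem_normalizer hg₀ _).mpr h.2

/-- Outside the division the count vanishes. -/
theorem natCard_conj_zpowers_eq_zero {σ z : G}
    (hz : ¬ ∃ g₀ : G, Subgroup.zpowers (g₀ * z * g₀⁻¹) = Subgroup.zpowers σ) :
    Nat.card {g : G // Subgroup.zpowers (g * z * g⁻¹) = Subgroup.zpowers σ} = 0 := by
  rw [Nat.card_eq_zero]
  exact Or.inl ⟨fun g => hz ⟨g.1, g.2⟩⟩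

variable [Fintype G]

/-- `Σ_z #{g : ⟨g z g⁻¹⟩ = ⟨σ⟩} = Σ_{d ∣ m} μ(d) · |G| · (m/d)` (`m = ord σ`): the Möbius count summed over
`z`, by the mean of the permutation characters. -/
theorem sum_natCard_conj_zpowers_eq (σ : G) :
    ∑ z : G, (Nat.card {g : G // Subgroup.zpowers (g * z * g⁻¹) = Subgroup.zpowers σ} : ℤ) =
      ∑ d ∈ (orderOf σ).divisors, (ArithmeticFunction.moebius d : ℤ) * (Nat.card G * (orderOf σ / d : ℕ)) := by
  classical
  simp_rw [← sum_moebius_card_conj]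
  rw [Finset.sum_comm]
  refine Finset.sum_congr rfl fun d hd => ?_
  have hdm : d ∣ orderOf σ := Nat.dvd_of_mem_divisors hd
  have hd0 : d ≠ 0 := Nat.pos_iff_ne_zero.mp (Nat.pos_of_mem_divisors hd)
  rw [← Finset.mul_sum, sum_card_conj_mem, natCard_zpowers_pow hdm hd0]

/-- **`|Div σ| · |N_G(⟨σ⟩)| = m · |G| · Σ_{d ∣ m} μ(d)/d`**: both sides equal `Σ_z #{g : ⟨g z g⁻¹⟩ = ⟨σ⟩}`. -/
theorem card_division_mul_card_normalizer (σ : G) :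
    (Nat.card {z : G // ∃ g : G, Subgroup.zpowers (g * z * g⁻¹) = Subgroup.zpowers σ} : ℝ) *
        Nat.card (Subgroup.normalizer (Subgroup.zpowers σ : Set G)) =
      orderOf σ * Nat.card G * ∑ d ∈ (orderOf σ).divisors, (ArithmeticFunction.moebius d : ℝ) / d := by
  classical
  set m : ℕ := orderOf σ with hm
  -- left side: `Σ_z #{g : …} = |N| · |Div|`
  have hL : ∑ z : G, (Nat.card {g : G // Subgroup.zpowers (g * z * g⁻¹) = Subgroup.zpowers σ} : ℤ) =
      (Nat.card {z : G // ∃ g : G, Subgroup.zpowers (g * z * g⁻¹) = Subgroup.zpowers σ} : ℤ) *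
        Nat.card (Subgroup.normalizer (Subgroup.zpowers σ : Set G)) := by
    have hpt : ∀ z : G, (Nat.card {g : G // Subgroup.zpowers (g * z * g⁻¹) = Subgroup.zpowers σ} : ℤ) =
        if ∃ g : G, Subgroup.zpowers (g * z * g⁻¹) = Subgroup.zpowers σ
          then (Nat.card (Subgroup.normalizer (Subgroup.zpowers σ : Set G)) : ℤ) else 0 := by
      intro z
      split_ifs with hz
      · rw [natCard_conj_zpowers_eq hz]
      · rw [natCard_conj_zpowers_eq_zero hz]; simp
    rw [Finset.sum_congr rfl fun z _ => hpt z, Finset.sum_ite, Finset.sum_const_zero, add_zero,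
      Finset.sum_const, nsmul_eq_mul]
    congr 1
    rw [Nat.card_eq_fintype_card (α := {z : G // ∃ g : G, Subgroup.zpowers (g * z * g⁻¹) = Subgroup.zpowers σ}),
      Fintype.card_subtype]
  -- right side in `ℝ`
  have hR := sum_natCard_conj_zpowers_eq σ
  rw [hL] at hR
  have hreal : ((Nat.card {z : G // ∃ g : G, Subgroup.zpowers (g * z * g⁻¹) = Subgroup.zpowers σ} : ℝ)) *
      (Nat.card (Subgroup.normalizer (Subgroup.zpowers σ : Set G)) : ℝ) =
      ∑ d ∈ m.divisors, (ArithmeticFunction.moebius d : ℝ) * (Nat.card G * ((m / d : ℕ) : ℝ)) := by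
    have h := congrArg (Int.cast (R := ℝ)) hR
    push_cast at h
    exact h
  have hdiv : ∀ d ∈ m.divisors, ((m / d : ℕ) : ℝ) = (m : ℝ) / d := by
    intro d hd
    rw [Nat.cast_div (Nat.dvd_of_mem_divisors hd)]
    exact_mod_cast (Nat.pos_of_mem_divisors hd).ne'
  rw [hreal, Finset.mul_sum]
  refine Finset.sum_congr rfl fun d hd => ?_
  rw [hdiv d hd]
  ring

/-- `σ` lies in its own division, so `1 ≤ |Div σ|`. -/
theorem one_le_card_division (σ : G) :
    1 ≤ Nat.card {z : G // ∃ g : G, Subgroup.zpowers (g * z * g⁻¹) = Subgroup.zpowers σ} := by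
  classical
  have : 0 < Nat.card {z : G // ∃ g : G, Subgroup.zpowers (g * z * g⁻¹) = Subgroup.zpowers σ} := by
    rw [Nat.card_pos_iff]
    exact ⟨⟨⟨σ, 1, by simp⟩⟩, inferInstance⟩
  exact this

/-- `|Div σ| ≤ |G|`. -/
theorem card_division_le (σ : G) :
    Nat.card {z : G // ∃ g : G, Subgroup.zpowers (g * z * g⁻¹) = Subgroup.zpowers σ} ≤ Nat.card G := by
  classical
  exact Nat.card_le_card_of_injective (fun z => z.1) Subtype.val_injective

/-- `ord σ ≤ |N_G(⟨σ⟩)|` (the normaliser contains `⟨σ⟩`). -/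
theorem orderOf_le_card_normalizer (σ : G) : orderOf σ ≤ Nat.card (Subgroup.normalizer (Subgroup.zpowers σ : Set G)) := by
  rw [← Nat.card_zpowers]
  exact Subgroup.card_le_of_le Subgroup.le_normalizer

/-- **The Chebotarev density of a division**: `|Div σ|/|G| = m · (Σ_{d ∣ m} μ(d)/d) / |N_G(⟨σ⟩)|`. -/
theorem divisionDensity_eq (σ : G) :
    (Nat.card {z : G // ∃ g : G, Subgroup.zpowers (g * z * g⁻¹) = Subgroup.zpowers σ} : ℝ) / Nat.card G =
      orderOf σ * (∑ d ∈ (orderOf σ).divisors, (ArithmeticFunction.moebius d : ℝ) / d) /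
        Nat.card (Subgroup.normalizer (Subgroup.zpowers σ : Set G)) := by
  have h := card_division_mul_card_normalizer σ
  have hG : (0 : ℝ) < Nat.card G := by exact_mod_cast (Nat.card_pos (α := G))
  have hN : (0 : ℝ) < Nat.card (Subgroup.normalizer (Subgroup.zpowers σ : Set G)) := by
    exact_mod_cast lt_of_lt_of_le (orderOf_pos σ) (orderOf_le_card_normalizer σ)
  field_simp
  linarith

end GroupTheory

/-! ### The exact prime sum behind the Möbius combination -/

section Primes

variable {N : Type} [Field N] [NumberField N] [IsGalois ℚ N]

/-- `|Σ_{d ∣ m} (μ(d)/d) a_{E_d}(p)| ≤ n²` at every prime (`n = [N:ℚ]`). -/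
theorem abs_divisionWeight_le (σ : N ≃ₐ[ℚ] N) {p : ℕ} (hp : p.Prime) :
    |∑ d ∈ (orderOf σ).divisors, (ArithmeticFunction.moebius d : ℝ) / d *
        (((splittingType (IntermediateField.fixedField (Subgroup.zpowers (σ ^ d))) p).count 1 : ℕ) : ℝ)| ≤
      (Module.finrank ℚ N : ℝ) ^ 2 := by
  classical
  set n : ℕ := Module.finrank ℚ N with hn
  have hterm : ∀ d ∈ (orderOf σ).divisors, |(ArithmeticFunction.moebius d : ℝ) / d *
      (((splittingType (IntermediateField.fixedField (Subgroup.zpowers (σ ^ d))) p).count 1 : ℕ) : ℝ)| ≤ n := by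
    intro d hd
    have hd1 : (1 : ℝ) ≤ d := by exact_mod_cast Nat.pos_of_mem_divisors hd
    have hμ : |(ArithmeticFunction.moebius d : ℝ)| ≤ 1 := by
      have := ArithmeticFunction.abs_moebius_le_one (n := d)
      exact_mod_cast this
    have hcount : (((splittingType (IntermediateField.fixedField (Subgroup.zpowers (σ ^ d))) p).count 1 : ℕ) : ℝ)
        ≤ n := by
      have h1 := count_one_splittingType_le_finrank (K := IntermediateField.fixedField (Subgroup.zpowers (σ ^ d))) hp
      have h2 : Module.finrank ℚ (IntermediateField.fixedField (Subgroup.zpowers (σ ^ d))) ≤ n := by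
        have h3 := Module.finrank_mul_finrank ℚ (IntermediateField.fixedField (Subgroup.zpowers (σ ^ d))) N
        have hpos : 0 < Module.finrank (IntermediateField.fixedField (Subgroup.zpowers (σ ^ d))) N :=
          Module.finrank_pos
        rw [hn, ← h3]
        exact Nat.le_mul_of_pos_right _ hpos
      exact_mod_cast h1.trans h2
    have hc0 : (0 : ℝ) ≤ (((splittingType (IntermediateField.fixedField (Subgroup.zpowers (σ ^ d))) p).count 1 : ℕ) : ℝ) :=
      Nat.cast_nonneg _
    rw [abs_mul, abs_of_nonneg hc0, abs_div, abs_of_pos (by linarith : (0 : ℝ) < d)]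
    have hμd : |(ArithmeticFunction.moebius d : ℝ)| / d ≤ 1 := by
      rw [div_le_one (by linarith)]; exact hμ.trans hd1
    calc |(ArithmeticFunction.moebius d : ℝ)| / d *
          (((splittingType (IntermediateField.fixedField (Subgroup.zpowers (σ ^ d))) p).count 1 : ℕ) : ℝ)
        ≤ 1 * (((splittingType (IntermediateField.fixedField (Subgroup.zpowers (σ ^ d))) p).count 1 : ℕ) : ℝ) :=
          mul_le_mul_of_nonneg_right hμd hc0
      _ ≤ n := by rw [one_mul]; exact hcount
  have hcard : ((orderOf σ).divisors.card : ℝ) ≤ n := by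
    have h1 : (orderOf σ).divisors.card ≤ orderOf σ := Nat.card_divisors_le_self _
    have h2 : orderOf σ ≤ n := by
      rw [hn, ← IsGalois.card_aut_eq_finrank, Nat.card_eq_fintype_card]
      exact orderOf_le_card_univ
    exact_mod_cast h1.trans h2
  have hn0 : (0 : ℝ) ≤ n := Nat.cast_nonneg _
  calc |∑ d ∈ (orderOf σ).divisors, (ArithmeticFunction.moebius d : ℝ) / d *
        (((splittingType (IntermediateField.fixedField (Subgroup.zpowers (σ ^ d))) p).count 1 : ℕ) : ℝ)|
      ≤ ∑ d ∈ (orderOf σ).divisors, |(ArithmeticFunction.moebius d : ℝ) / d *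
        (((splittingType (IntermediateField.fixedField (Subgroup.zpowers (σ ^ d))) p).count 1 : ℕ) : ℝ)| :=
        Finset.abs_sum_le_sum_abs _ _
    _ ≤ ∑ _d ∈ (orderOf σ).divisors, (n : ℝ) := Finset.sum_le_sum hterm
    _ = (orderOf σ).divisors.card * n := by rw [Finset.sum_const, nsmul_eq_mul]
    _ ≤ n * n := mul_le_mul_of_nonneg_right hcard hn0
    _ = (n : ℝ) ^ 2 := by ring

open scoped Classical in
/-- **The division weight at an unramified prime is `(|N_G(⟨σ⟩)|/m) · 𝟙[Frob_p ∈ Div σ]`.** -/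
theorem divisionWeight_eq_ite (σ : N ≃ₐ[ℚ] N) {p : ℕ} (hp : p.Prime) (hd : ¬ ((p : ℤ) ∣ NumberField.discr N)) :
    ∑ d ∈ (orderOf σ).divisors, (ArithmeticFunction.moebius d : ℝ) / d *
        (((splittingType (IntermediateField.fixedField (Subgroup.zpowers (σ ^ d))) p).count 1 : ℕ) : ℝ) =
      if ∃ (Q : Ideal (𝓞 N)) (_ : Q.IsMaximal) (_ : Q.LiesOver (span {(p : ℤ)})) (φ g : N ≃ₐ[ℚ] N),
          IsArithFrobAt ℤ φ Q ∧ Q.inertia (N ≃ₐ[ℚ] N) = ⊥ ∧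
            Subgroup.zpowers (g * φ * g⁻¹) = Subgroup.zpowers σ
        then (Nat.card (Subgroup.normalizer (Subgroup.zpowers σ : Set (N ≃ₐ[ℚ] N))) : ℝ) / orderOf σ else 0 := by
  split_ifs with hgood
  · obtain ⟨Q, hQmax, hQover, φ, g, hφ, hI, hg⟩ := hgood
    haveI := hQmax
    haveI := hQover
    rw [divisionWeight_eq σ hp Q hφ hI, natCard_conj_zpowers_eq ⟨g, hg⟩]
  · obtain ⟨Q₀, hQ₀max, hQ₀over, ⟨φ, hφ⟩, hI⟩ := exists_isArithFrobAt_of_not_dvd_discr (N := N) hp hd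
    rw [divisionWeight_eq σ hp Q₀ hφ hI]
    have h0 : Nat.card {g : N ≃ₐ[ℚ] N // Subgroup.zpowers (g * φ * g⁻¹) = Subgroup.zpowers σ} = 0 := by
      apply natCard_conj_zpowers_eq_zero
      rintro ⟨g, hg⟩
      exact hgood ⟨Q₀, hQ₀max, hQ₀over, φ, g, hφ, hI, hg⟩
    rw [h0, Nat.cast_zero, zero_div]

open scoped Classical in
/-- **The exact prime sum behind the Möbius combination of Dedekind zetas**: for every `x`,
`|Σ_{d ∣ m} (μ(d)/d) θ¹_{E_d}(x) − (|N_G(⟨σ⟩)|/m) · Σ_{p ≤ x, p ∤ d_N, Frob_p ∈ Div σ} log p| ≤ n² log|d_N|`. -/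
theorem abs_divisionTheta_sub_le (σ : N ≃ₐ[ℚ] N) (x : ℝ) :
    |∑ d ∈ (orderOf σ).divisors, (ArithmeticFunction.moebius d : ℝ) / d *
        degreeOneTheta (IntermediateField.fixedField (Subgroup.zpowers (σ ^ d))) x -
      (Nat.card (Subgroup.normalizer (Subgroup.zpowers σ : Set (N ≃ₐ[ℚ] N))) : ℝ) / orderOf σ *
        ∑ p ∈ (Nat.primesLE ⌊x⌋₊).filter
          (fun p : ℕ => ¬ ((p : ℤ) ∣ NumberField.discr N) ∧
            ∃ (Q : Ideal (𝓞 N)) (_ : Q.IsMaximal) (_ : Q.LiesOver (span {(p : ℤ)})) (φ g : N ≃ₐ[ℚ] N),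
              IsArithFrobAt ℤ φ Q ∧ Q.inertia (N ≃ₐ[ℚ] N) = ⊥ ∧
                Subgroup.zpowers (g * φ * g⁻¹) = Subgroup.zpowers σ), Real.log p| ≤
      (Module.finrank ℚ N : ℝ) ^ 2 * Real.log ((NumberField.discr N).natAbs : ℝ) := by
  classical
  set n : ℕ := Module.finrank ℚ N with hn
  set ν : ℝ := (Nat.card (Subgroup.normalizer (Subgroup.zpowers σ : Set (N ≃ₐ[ℚ] N))) : ℝ) / orderOf σ with hν
  set u : ℕ → ℝ := fun p => ∑ d ∈ (orderOf σ).divisors, (ArithmeticFunction.moebius d : ℝ) / d *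
    (((splittingType (IntermediateField.fixedField (Subgroup.zpowers (σ ^ d))) p).count 1 : ℕ) : ℝ) with hu
  set P : ℕ → Prop := fun p => ∃ (Q : Ideal (𝓞 N)) (_ : Q.IsMaximal) (_ : Q.LiesOver (span {(p : ℤ)}))
      (φ g : N ≃ₐ[ℚ] N), IsArithFrobAt ℤ φ Q ∧ Q.inertia (N ≃ₐ[ℚ] N) = ⊥ ∧
        Subgroup.zpowers (g * φ * g⁻¹) = Subgroup.zpowers σ with hP
  -- the left sum is `Σ_p u(p) log p`
  have hT : ∑ d ∈ (orderOf σ).divisors, (ArithmeticFunction.moebius d : ℝ) / d *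
      degreeOneTheta (IntermediateField.fixedField (Subgroup.zpowers (σ ^ d))) x =
      ∑ p ∈ Nat.primesLE ⌊x⌋₊, u p * Real.log p := by
    simp_rw [degreeOneTheta_eq_sum_count_one, Finset.mul_sum, hu, Finset.sum_mul]
    rw [Finset.sum_comm]
    refine Finset.sum_congr rfl fun p _ => Finset.sum_congr rfl fun d _ => by ring
  -- split the primes into unramified and ramified
  set R : Finset ℕ := (Nat.primesLE ⌊x⌋₊).filter (fun p : ℕ => (p : ℤ) ∣ NumberField.discr N) with hR
  set U : Finset ℕ := (Nat.primesLE ⌊x⌋₊).filter (fun p : ℕ => ¬ ((p : ℤ) ∣ NumberField.discr N)) with hU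
  have hsplit : ∑ p ∈ Nat.primesLE ⌊x⌋₊, u p * Real.log p =
      ∑ p ∈ U, u p * Real.log p + ∑ p ∈ R, u p * Real.log p := by
    rw [hU, hR, ← Finset.sum_filter_add_sum_filter_not (Nat.primesLE ⌊x⌋₊)
      (fun p : ℕ => ¬ ((p : ℤ) ∣ NumberField.discr N))]
    congr 1
    refine Finset.sum_congr ?_ fun _ _ => rfl
    ext p; simp
  -- unramified primes: `u(p) = ν · 𝟙[P p]`
  have hUsum : ∑ p ∈ U, u p * Real.log p =
      ν * ∑ p ∈ (Nat.primesLE ⌊x⌋₊).filter (fun p : ℕ => ¬ ((p : ℤ) ∣ NumberField.discr N) ∧ P p),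
        Real.log p := by
    have hpt : ∀ p ∈ U, u p * Real.log p = ν * (if P p then Real.log p else 0) := by
      intro p hp
      rw [hU, Finset.mem_filter] at hp
      have hp' := (Nat.mem_primesLE.mp hp.1).2
      have key := divisionWeight_eq_ite σ hp' hp.2
      have hup : u p = if P p then ν else 0 := by
        simp only [hu, hν, hP]
        exact key
      rw [hup]
      split_ifs <;> ring
    rw [Finset.sum_congr rfl hpt, ← Finset.mul_sum, ← Finset.sum_filter]
    congr 1
    rw [hU, Finset.filter_filter]
  -- ramified primes: `|Σ_R u log p| ≤ n² log|d_N|`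
  have hRsum : |∑ p ∈ R, u p * Real.log p| ≤ (n : ℝ) ^ 2 * Real.log ((NumberField.discr N).natAbs : ℝ) := by
    have hram := sum_primesLE_filter_dvd_discr_log_le N ⌊x⌋₊
    calc |∑ p ∈ R, u p * Real.log p| ≤ ∑ p ∈ R, |u p * Real.log p| := Finset.abs_sum_le_sum_abs _ _
      _ ≤ ∑ p ∈ R, (n : ℝ) ^ 2 * Real.log p := by
          refine Finset.sum_le_sum fun p hp => ?_
          rw [hR, Finset.mem_filter] at hp
          have hp' := (Nat.mem_primesLE.mp hp.1).2
          have hlog : 0 ≤ Real.log p := Real.log_natCast_nonneg p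
          rw [abs_mul, abs_of_nonneg hlog]
          exact mul_le_mul_of_nonneg_right (abs_divisionWeight_le σ hp') hlog
      _ = (n : ℝ) ^ 2 * ∑ p ∈ R, Real.log p := by rw [Finset.mul_sum]
      _ ≤ (n : ℝ) ^ 2 * Real.log ((NumberField.discr N).natAbs : ℝ) :=
          mul_le_mul_of_nonneg_left hram (by positivity)
  rw [hT, hsplit, hUsum]
  have e : ν * ∑ p ∈ (Nat.primesLE ⌊x⌋₊).filter (fun p : ℕ => ¬ ((p : ℤ) ∣ NumberField.discr N) ∧ P p),
      Real.log p + ∑ p ∈ R, u p * Real.log p -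
      ν * ∑ p ∈ (Nat.primesLE ⌊x⌋₊).filter (fun p : ℕ => ¬ ((p : ℤ) ∣ NumberField.discr N) ∧ P p),
      Real.log p = ∑ p ∈ R, u p * Real.log p := by ring
  rw [e]
  exact hRsum

end Primes

end Summit.QuantumAdvantage.QuantumAdvantage.Theorems.DegreeOnePrimesEscape

end
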